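import Summits.ResolutionOfSingularities.ResolutionOfSingularities.Theorems.MarkedTransferCampaignW12SandwichBoxCriterion
import Literature.AlgebraicGeometry.Hironaka2017.NegaWitness
import Literature.AlgebraicGeometry.Resolution.DerivativeIdeals
import Mathlib.RingTheory.MvPolynomial.Ideal
import Mathlib.Algebra.MvPolynomial.PDeriv
import Mathlib.Algebra.CharP.Two
import HarnessLib

/-!
# [OURS · L1 W1.2 · V1] The box-flat class V1 is NOT stable under a FORCED permissible blow-up:
# `E = (y² + x²w + xw², 2)` over `𝔽₂` — isolated singular point, V1 at `ξ`, and after the point blow-up the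
# transform `E′ = (y₁² + x w₁ + x w₁², 2)` carries the box monomial `x w₁` at the singular point `ξ′`, so the
# sandwich negative modules are NOT contained in `𝔪_{ξ′}` (seat res-L1-s12-pv-1)

LADDER-RESOLUTION rung L (rescue), cell `res-hironaka`, RESCUE-SEED §1 slot **W1.2**, variant **V1** = «sandwich +
box-flat heads: `g = y^q + ε`, `ε ∈ 𝔪^{[q]}`» (res-L1-k12 KILL-TEST-K1.2 §5; director 21:05:07Z). CONSUMER TEST
(res-plan-2 21:27:13Z, accepted 21:27:42Z): «it has CONTENT iff V1 is STABLE under the typed Th 16.6 blow-ups and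
contains Prop 9.1's h». This file is a kernel datum for the first conjunct, numbers not adjectives:

* `E = ((g), 2)`, `g = y² + x²w + xw² ∈ 𝔽₂[x,y,w]` (`X 0 = x`, `X 1 = y`, `X 2 = w`), `ξ = 0`, `q = m = 2 = p`,
  `e = 1`. V1 HOLDS at `ξ`: `ε = x²w + xw² ∈ 𝔪^{[2]} = (x²,y²,w²)` (`V1ex_tail_mem_box`); `g ∈ 𝔪²` (`V1ex_mem_sq`,
  `ξ ∈ Sing(E)`, the point is a permissible centre).
* THE CENTRE IS FORCED: `(x², y², w²) ⊆ Diff^{≤1}((g))` (`V1ex_box_le_diffIdeal_one`: `∂_x g = w²`, `∂_w g = x²`,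
  `y² = g + ε`), so the locus `{ord ≥ 2} = V(Diff^{≤1}(g))` of `E` is (set-theoretically) `{ξ}`: EVERY permissible
  centre — whatever centre rule a procedure uses (Th 16.6 (1): «`D` … smooth closed irreducible … ⊂ ∇(E)` ⊂ Sing(E)»)
  — is the point `ξ`.
* After blowing up `ξ`, x-chart `(x, y, w) = (x, x y₁, x w₁)` (tree `Nega.xChart`): `g ↦ x²·g′`,
  `g′ = y₁² + x w₁ + x w₁²` (`V1ex_xChart`); `ξ′ = 0` is SINGULAR for `E′ = ((g′),2)` (`g′ ∈ 𝔪′²`, `V1ex'_mem_sq`) with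
  (37) (`g′ ∉ 𝔪′³`, `V1ex'_not_mem_cube`), and `g′ ∉ 𝔪′^{[2]}` (`V1ex'_not_mem_box`: the box monomial `x w₁` has
  coefficient `1`) — so `E′` violates the V1 box condition at `ξ′` INTRINSICALLY (`𝔪′^{[2]}` is the Frobenius power, no
  coordinates involved: `℘(E′,2) ∋ g′ ⊄ 𝔪′^{[2]}`), and by the box criterion (p469591) the sandwich negative modules
  `℘nega_sw(E′,−a)`, `a ≤ 2`, are NOT contained in `𝔪_{ξ′}` for ANY family `P′ ∋ g′` (`V1ex'_sandwichPNega_not_le`):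
  the no-unit property is LOST after one forced blow-up. (`∂_x∂_{w₁} g′ = 1` is the unit; order `2 ≤ m + a`.)
* Summary `V1_not_stable_under_forced_pointBlowup`.

Not claimed: that `ξ′` is a point «with `Inv_{ξ′}(E′) = Inv_ξ(E)`» (Th 7.8's clause) — the tangent cone changes from
`y²` to `y₁² + x w₁`; the datum is about the CLASS V1 along the resolution tree (the procedure must continue at `ξ′`,
`ord_{ξ′} g′ = 2 = b`), which is what «V1 stable under the blow-ups» quantifies over. Which repair survives
(hereditary V1, V2 order window, …) is the planners' (res-plan-2 / res-adj-1), not asserted here.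

HONEST FRAMING. OURS statements about OUR objects (`Campaign.sandwichPNega`); Def 5.1 (p.25), Th 16.6 (p.84) are
CANDIDATES [claim: Hironaka2017, status: under-review]; nothing here is a statement of the manuscript, a verdict on a
GAP row, or progress on resolution of singularities in positive characteristic. Elementary identities over `𝔽₂`
([folklore]). BARRIER LINE as in p467195 (`FrobeniusTwistResolution.*`). AI proof is weaker than expert review.
-/

noncomputable section

set_option linter.dupNamespace false -- mandated namespace of this single-conjunct summit

namespace Summit.ResolutionOfSingularities.ResolutionOfSingularities.Theorems.Campaign.W12

open MvPolynomial
open Literature.AlgebraicGeometry.Resolution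
open Literature.AlgebraicGeometry.Hironaka2017
open Summit.ResolutionOfSingularities.ResolutionOfSingularities.Theorems.Campaign

/-! ## The datum `E = (y² + x²w + xw², 2)` at `ξ = 0` -/

/-- V1 at `ξ`: the tail `ε = x²w + xw²` lies in the box ideal `𝔪^{[2]} = 𝔪.map ρ = (x², y², w²)`. [folklore] -/
theorem V1ex_tail_mem_box :
    (X 0 ^ 2 * X 2 + X 0 * X 2 ^ 2 : MvPolynomial (Fin 3) (ZMod 2)) ∈
      (idealOfVars (Fin 3) (ZMod 2)).map (iterateFrobenius (MvPolynomial (Fin 3) (ZMod 2)) 2 1) := by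
  rw [map_iterateFrobenius_idealOfVars]
  refine Ideal.add_mem _ ?_ ?_
  · exact Ideal.mul_mem_right _ _ (Ideal.subset_span ⟨0, by simp⟩)
  · exact Ideal.mul_mem_left _ _ (Ideal.subset_span ⟨2, by simp⟩)

/-- `ξ ∈ Sing(E)`: `g ∈ 𝔪²` (so the point `ξ` is a permissible centre for `E = ((g),2)`). [folklore] -/
theorem V1ex_mem_sq :
    (X 1 ^ 2 + X 0 ^ 2 * X 2 + X 0 * X 2 ^ 2 : MvPolynomial (Fin 3) (ZMod 2)) ∈ idealOfVars (Fin 3) (ZMod 2) ^ 2 := by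
  have hX : ∀ i : Fin 3, (X i : MvPolynomial (Fin 3) (ZMod 2)) ∈ idealOfVars (Fin 3) (ZMod 2) := fun i =>
    Ideal.subset_span (Set.mem_range_self i)
  have h02 : (X 0 * X 2 : MvPolynomial (Fin 3) (ZMod 2)) ∈ idealOfVars (Fin 3) (ZMod 2) ^ 2 := by
    rw [pow_two]; exact Ideal.mul_mem_mul (hX 0) (hX 2)
  refine Ideal.add_mem _ (Ideal.add_mem _ (Ideal.pow_mem_pow (hX 1) 2) ?_) ?_
  · exact Ideal.mul_mem_right _ _ (Ideal.pow_mem_pow (hX 0) 2)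
  · rw [show (X 0 * X 2 ^ 2 : MvPolynomial (Fin 3) (ZMod 2)) = X 0 * X 2 * X 2 by ring]
    exact Ideal.mul_mem_right _ _ h02

/-- `∂_x g = w²` (characteristic `2`). [folklore] -/
theorem V1ex_pderiv_zero :
    pderiv 0 (X 1 ^ 2 + X 0 ^ 2 * X 2 + X 0 * X 2 ^ 2 : MvPolynomial (Fin 3) (ZMod 2)) = X 2 ^ 2 := by
  have h1 : pderiv 0 (X 1 : MvPolynomial (Fin 3) (ZMod 2)) = 0 := pderiv_X_of_ne (by decide)
  have h2 : pderiv 0 (X 2 : MvPolynomial (Fin 3) (ZMod 2)) = 0 := pderiv_X_of_ne (by decide)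
  simp only [map_add, Derivation.leibniz, Derivation.leibniz_pow, pderiv_X_self, h1, h2, smul_eq_mul, nsmul_eq_mul,
    mul_zero, zero_add, smul_zero, mul_one]
  linear_combination (X 2 * X 0 : MvPolynomial (Fin 3) (ZMod 2)) *
    (CharTwo.two_eq_zero : (2 : MvPolynomial (Fin 3) (ZMod 2)) = 0)

/-- `∂_w g = x²` (characteristic `2`). [folklore] -/
theorem V1ex_pderiv_two :
    pderiv 2 (X 1 ^ 2 + X 0 ^ 2 * X 2 + X 0 * X 2 ^ 2 : MvPolynomial (Fin 3) (ZMod 2)) = X 0 ^ 2 := by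
  have h1 : pderiv 2 (X 1 : MvPolynomial (Fin 3) (ZMod 2)) = 0 := pderiv_X_of_ne (by decide)
  have h0 : pderiv 2 (X 0 : MvPolynomial (Fin 3) (ZMod 2)) = 0 := pderiv_X_of_ne (by decide)
  simp only [map_add, Derivation.leibniz, Derivation.leibniz_pow, pderiv_X_self, h1, h0, smul_eq_mul, nsmul_eq_mul,
    mul_zero, zero_add, smul_zero, add_zero, mul_one]
  linear_combination (X 0 * X 2 : MvPolynomial (Fin 3) (ZMod 2)) *
    (CharTwo.two_eq_zero : (2 : MvPolynomial (Fin 3) (ZMod 2)) = 0)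

/-- **The centre is forced**: `(x², y², w²) ⊆ Diff^{≤1}((g))` — so `V(Diff^{≤1}(g)) = {ord_P g ≥ 2} ⊆ V(x²,y²,w²) = {ξ}`:
the singular locus of `E = ((g),2)` is the single point `ξ`, hence every permissible centre is `{ξ}` (tree
`pderiv_mem_derivIdeal`, `derivIdeal_le_diffIdeal_one`). [folklore] -/
theorem V1ex_box_le_diffIdeal_one :
    Ideal.span (Set.range fun i : Fin 3 => (X i : MvPolynomial (Fin 3) (ZMod 2)) ^ 2) ≤
      diffIdeal (ZMod 2) 1 (Ideal.span {(X 1 ^ 2 + X 0 ^ 2 * X 2 + X 0 * X 2 ^ 2 : MvPolynomial (Fin 3) (ZMod 2))}) := by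
  set g : MvPolynomial (Fin 3) (ZMod 2) := X 1 ^ 2 + X 0 ^ 2 * X 2 + X 0 * X 2 ^ 2 with hg
  have hgI : g ∈ Ideal.span {g} := Ideal.mem_span_singleton_self g
  have hD : derivIdeal (ZMod 2) (Ideal.span {g}) ≤ diffIdeal (ZMod 2) 1 (Ideal.span {g}) :=
    derivIdeal_le_diffIdeal_one (ZMod 2) _
  have hx2 : (X 0 : MvPolynomial (Fin 3) (ZMod 2)) ^ 2 ∈ diffIdeal (ZMod 2) 1 (Ideal.span {g}) := by
    have h := hD (pderiv_mem_derivIdeal (ZMod 2) 2 hgI)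
    rwa [hg, V1ex_pderiv_two] at h
  have hw2 : (X 2 : MvPolynomial (Fin 3) (ZMod 2)) ^ 2 ∈ diffIdeal (ZMod 2) 1 (Ideal.span {g}) := by
    have h := hD (pderiv_mem_derivIdeal (ZMod 2) 0 hgI)
    rwa [hg, V1ex_pderiv_zero] at h
  have hy2 : (X 1 : MvPolynomial (Fin 3) (ZMod 2)) ^ 2 ∈ diffIdeal (ZMod 2) 1 (Ideal.span {g}) := by
    have hsum : (X 1 : MvPolynomial (Fin 3) (ZMod 2)) ^ 2 = g - (X 0 ^ 2 * X 2 + X 0 * X 2 ^ 2) := by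
      rw [hg]; ring
    rw [hsum]
    refine Ideal.sub_mem _ (le_diffIdeal (ZMod 2) 1 _ hgI) (Ideal.add_mem _ ?_ ?_)
    · exact Ideal.mul_mem_right _ _ hx2
    · exact Ideal.mul_mem_left _ _ hw2
  refine Ideal.span_le.mpr ?_
  rintro _ ⟨i, rfl⟩
  fin_cases i
  · exact hx2
  · exact hy2
  · exact hw2

/-! ## The first transform `E′ = (y₁² + x w₁ + x w₁², 2)` at `ξ′ = 0` (x-chart) -/

/-- Chart identity: `g(x, x y₁, x w₁) = x² · g′`, `g′ = y₁² + x w₁ + x w₁²` (total transform = `I(D)^2 ·` controlled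
transform; tree `Nega.xChart`). [folklore] -/
theorem V1ex_xChart :
    Nega.xChart (X 1 ^ 2 + X 0 ^ 2 * X 2 + X 0 * X 2 ^ 2)
      = (X 0 ^ 2 * (X 1 ^ 2 + X 0 * X 2 + X 0 * X 2 ^ 2) : MvPolynomial (Fin 3) (ZMod 2)) := by
  simp only [Nega.xChart, map_add, map_mul, map_pow, aeval_X]
  simp [Matrix.cons_val]
  ring

/-- `ξ′ ∈ Sing(E′)`: `g′ ∈ 𝔪′²` (`ord_{ξ′} g′ ≥ 2 = b`; the procedure must continue at `ξ′`). [folklore] -/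
theorem V1ex'_mem_sq :
    (X 1 ^ 2 + X 0 * X 2 + X 0 * X 2 ^ 2 : MvPolynomial (Fin 3) (ZMod 2)) ∈ idealOfVars (Fin 3) (ZMod 2) ^ 2 := by
  have hX : ∀ i : Fin 3, (X i : MvPolynomial (Fin 3) (ZMod 2)) ∈ idealOfVars (Fin 3) (ZMod 2) := fun i =>
    Ideal.subset_span (Set.mem_range_self i)
  have h02 : (X 0 * X 2 : MvPolynomial (Fin 3) (ZMod 2)) ∈ idealOfVars (Fin 3) (ZMod 2) ^ 2 := by
    rw [pow_two]; exact Ideal.mul_mem_mul (hX 0) (hX 2)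
  refine Ideal.add_mem _ (Ideal.add_mem _ (Ideal.pow_mem_pow (hX 1) 2) h02) ?_
  rw [show (X 0 * X 2 ^ 2 : MvPolynomial (Fin 3) (ZMod 2)) = X 0 * X 2 * X 2 by ring]
  exact Ideal.mul_mem_right _ _ h02

/-- `g′` as a sum of monomials. [folklore] -/
theorem V1ex'_eq_monomials :
    (X 1 ^ 2 + X 0 * X 2 + X 0 * X 2 ^ 2 : MvPolynomial (Fin 3) (ZMod 2)) =
      monomial (Finsupp.single 1 2) 1 + monomial (Finsupp.single 0 1 + Finsupp.single 2 1) 1 +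
        monomial (Finsupp.single 0 1 + Finsupp.single 2 2) 1 := by
  rw [X_pow_eq_monomial, X_pow_eq_monomial]
  simp only [X, monomial_mul, mul_one]

/-- The coefficient of the head `y₁²` in `g′` is `1`. [folklore] -/
theorem V1ex'_coeff_head :
    coeff (Finsupp.single 1 2) (X 1 ^ 2 + X 0 * X 2 + X 0 * X 2 ^ 2 : MvPolynomial (Fin 3) (ZMod 2)) = 1 := by
  rw [V1ex'_eq_monomials, coeff_add, coeff_add, coeff_monomial, coeff_monomial, coeff_monomial, if_pos rfl,
    if_neg, if_neg]
  · simp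
  · intro h; have := DFunLike.congr_fun h 1; simp at this
  · intro h; have := DFunLike.congr_fun h 1; simp at this

/-- **The box monomial**: the coefficient of `x w₁` (multi-index `e_0 + e_2`, all exponents `< 2`) in `g′` is `1`.
[folklore] -/
theorem V1ex'_coeff_box :
    coeff (Finsupp.single 0 1 + Finsupp.single 2 1)
      (X 1 ^ 2 + X 0 * X 2 + X 0 * X 2 ^ 2 : MvPolynomial (Fin 3) (ZMod 2)) = 1 := by
  rw [V1ex'_eq_monomials, coeff_add, coeff_add, coeff_monomial, coeff_monomial, coeff_monomial, if_neg, if_pos rfl,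
    if_neg]
  · simp
  · intro h; have := DFunLike.congr_fun h 2; simp at this
  · intro h; have := DFunLike.congr_fun h 1; simp at this

/-- (37) at `ξ′`: `g′ ∉ 𝔪′³` (`ord_{ξ′} g′ = 2` exactly; the monomial `y₁²` of degree `2 < 3` survives). [folklore] -/
theorem V1ex'_not_mem_cube :
    (X 1 ^ 2 + X 0 * X 2 + X 0 * X 2 ^ 2 : MvPolynomial (Fin 3) (ZMod 2)) ∉ idealOfVars (Fin 3) (ZMod 2) ^ 3 := by
  intro h
  rw [mem_pow_idealOfVars_iff'] at h
  have := h (Finsupp.single 1 2) (by simp)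
  rw [V1ex'_coeff_head] at this
  exact one_ne_zero this

/-- The multi-index `e_0 + e_2` is a box (all exponents `< 2 = p^e`). [folklore] -/
theorem box_e0_add_e2 :
    ∀ i : Fin 3, (Finsupp.single (0 : Fin 3) (1 : ℕ) + Finsupp.single (2 : Fin 3) (1 : ℕ)) i < 2 ^ 1 := by
  intro i
  fin_cases i <;> simp

/-- **`E′` violates the V1 box condition at `ξ′`, intrinsically**: `g′ ∉ 𝔪′^{[2]} = 𝔪′.map ρ` (the Frobenius power —
coordinate-free), because of the box monomial `x w₁`. Hence `℘(E′,2) ∋ g′ ⊄ 𝔪′^{[2]}`. [folklore] -/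
theorem V1ex'_not_mem_box :
    (X 1 ^ 2 + X 0 * X 2 + X 0 * X 2 ^ 2 : MvPolynomial (Fin 3) (ZMod 2)) ∉
      (idealOfVars (Fin 3) (ZMod 2)).map (iterateFrobenius (MvPolynomial (Fin 3) (ZMod 2)) 2 1) := by
  rw [map_iterateFrobenius_idealOfVars]
  intro h
  have := coeff_eq_zero_of_mem_of_box 2 1 h box_e0_add_e2
  rw [V1ex'_coeff_box] at this
  exact one_ne_zero this

/-- **The no-unit property is LOST at `ξ′`**: for EVERY family `P′` («`P′ j = ℘(E′,j)`») with `g′ ∈ P′(2)` (Th 4.1 (1)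
shape) and every degree `−a`, `a ≤ 2`: `¬ ℘nega_sw(E′,−a) ⊆ 𝔪_{ξ′}` at level `e = 1`, `m = q = 2` — the box operator
`∂_x∂_{w₁}` (order `2 ≤ m + a`, `ρ`-linear) takes `g′` to a polynomial with constant term `1` (box criterion p469591
`not_sandwichPNega_le_idealOfVars`). [folklore] -/
theorem V1ex'_sandwichPNega_not_le (P' : ℕ → Ideal (MvPolynomial (Fin 3) (ZMod 2)))
    (hg : (X 1 ^ 2 + X 0 * X 2 + X 0 * X 2 ^ 2 : MvPolynomial (Fin 3) (ZMod 2)) ∈ P' 2) {a : ℕ} (ha : a ≤ 2) :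
    ¬ sandwichPNega 2 1 P' 2 a ≤ idealOfVars (Fin 3) (ZMod 2) := by
  have hdeg : (Finsupp.single (0 : Fin 3) 1 + Finsupp.single 2 1).degree ≤ 1 * 2 + a := by
    simp [map_add, Finsupp.degree_single]
  refine not_sandwichPNega_le_idealOfVars 2 1 P' 2 a 1 (by omega) (by norm_num) box_e0_add_e2 hdeg
    (by simpa using hg) ?_
  rw [V1ex'_coeff_box]
  exact one_ne_zero

/-- **SUMMARY — V1 is not stable under a forced permissible blow-up.** For `E = (y² + x²w + xw², 2)` over `𝔽₂`
(`q = m = p = 2`, `e = 1`): (1) V1 at `ξ` (`ε ∈ 𝔪^{[2]}`); (2) `ξ ∈ Sing(E)` and `Sing(E) ⊆ {ξ}` (`(x²,y²,w²) ⊆ Diff^{≤1}(g)`),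
so the point blow-up is the only permissible move; (3) in the x-chart `g ↦ x²·g′`; (4) `ξ′ ∈ Sing(E′)` with (37);
(5) `g′ ∉ 𝔪′^{[2]}` (V1's box condition fails at `ξ′` in every coordinate system); (6) for every family `P′ ∋ g′` in
degree `2`, the sandwich negative modules of degrees `0, −1, −2` are not contained in `𝔪_{ξ′}`. [folklore] -/
theorem V1_not_stable_under_forced_pointBlowup :
    (X 0 ^ 2 * X 2 + X 0 * X 2 ^ 2 : MvPolynomial (Fin 3) (ZMod 2)) ∈
        (idealOfVars (Fin 3) (ZMod 2)).map (iterateFrobenius (MvPolynomial (Fin 3) (ZMod 2)) 2 1) ∧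
      (X 1 ^ 2 + X 0 ^ 2 * X 2 + X 0 * X 2 ^ 2 : MvPolynomial (Fin 3) (ZMod 2)) ∈ idealOfVars (Fin 3) (ZMod 2) ^ 2 ∧
      Ideal.span (Set.range fun i : Fin 3 => (X i : MvPolynomial (Fin 3) (ZMod 2)) ^ 2) ≤
        diffIdeal (ZMod 2) 1
          (Ideal.span {(X 1 ^ 2 + X 0 ^ 2 * X 2 + X 0 * X 2 ^ 2 : MvPolynomial (Fin 3) (ZMod 2))}) ∧
      Nega.xChart (X 1 ^ 2 + X 0 ^ 2 * X 2 + X 0 * X 2 ^ 2)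
        = (X 0 ^ 2 * (X 1 ^ 2 + X 0 * X 2 + X 0 * X 2 ^ 2) : MvPolynomial (Fin 3) (ZMod 2)) ∧
      ((X 1 ^ 2 + X 0 * X 2 + X 0 * X 2 ^ 2 : MvPolynomial (Fin 3) (ZMod 2)) ∈ idealOfVars (Fin 3) (ZMod 2) ^ 2 ∧
        (X 1 ^ 2 + X 0 * X 2 + X 0 * X 2 ^ 2 : MvPolynomial (Fin 3) (ZMod 2)) ∉ idealOfVars (Fin 3) (ZMod 2) ^ 3) ∧
      (X 1 ^ 2 + X 0 * X 2 + X 0 * X 2 ^ 2 : MvPolynomial (Fin 3) (ZMod 2)) ∉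
        (idealOfVars (Fin 3) (ZMod 2)).map (iterateFrobenius (MvPolynomial (Fin 3) (ZMod 2)) 2 1) ∧
      ∀ P' : ℕ → Ideal (MvPolynomial (Fin 3) (ZMod 2)),
        (X 1 ^ 2 + X 0 * X 2 + X 0 * X 2 ^ 2 : MvPolynomial (Fin 3) (ZMod 2)) ∈ P' 2 →
          ∀ a ≤ 2, ¬ sandwichPNega 2 1 P' 2 a ≤ idealOfVars (Fin 3) (ZMod 2) :=
  ⟨V1ex_tail_mem_box, V1ex_mem_sq, V1ex_box_le_diffIdeal_one, V1ex_xChart, ⟨V1ex'_mem_sq, V1ex'_not_mem_cube⟩,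
    V1ex'_not_mem_box, fun P' hg _ ha => V1ex'_sandwichPNega_not_le P' hg ha⟩

end Summit.ResolutionOfSingularities.ResolutionOfSingularities.Theorems.Campaign.W12

end
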